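import Mathlib
import Summits.NavierStokesRegularity.NavierStokesRegularity.Theorems.TaoLadderRungTwoFlatEntryHop
import HarnessLib

/-!
# THE ENTRY HOP IN ONE CALL: clock ∧ envelope ∧ landing of the split R54 tube at `n = N₀` (the `hentry` input of `gapData₂On_of_phases`)
  (helper for the K_A♭ parent item stmt-NavierStokesRegularity-22987 `FlatGapCertificatesV2`, child 2A `GradedAdiabaticWakeA` of route
  TaoLadderRungTwoFlat; cell harvest/h2-tao-ladder, p1 g25; LADDER §50, §52)

With `…CapturePhase` (capture hops, p728691), `…EntryHop` (entry landing, p729183) and `…TubeStepSplit` (tube hops, p727068) every phase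
input of `gapData₂On_of_phases` (p727276) now has a ONE-CALL producer whose remaining hypotheses are reference flows (the pulse flow `U`,
the capture references `Z^n`), E2 readouts along premise flows at tube hops, and scalar rows.

* `entryHop_of_continuity` — `TubeStepClockWith ∧ TubeStepEnvelopeWith ∧ TubeStepLandWith` at `n = N₀` from the reference flow of the entry
  hop: clock/envelope by `tubeStepClockWith_of_continuity` / `tubeStepEnvelopeWith_of_continuity`, landing by
  `tubeStepLandWith_entry_of_continuity`.

HONEST FRAMING: composition over the cell's typed induction frame (MODEL lattice, graded mirror table on `S♭`); reference flows, rows and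
budgets are HYPOTHESES; nothing certified; no item closed; nothing about the Navier–Stokes equations.
-/

noncomputable section

-- the sub-problem namespace repeats the summit name by design (D-0017)
set_option linter.dupNamespace false

namespace Summit.NavierStokesRegularity.NavierStokesRegularity.Theorems.HopTube

open Set Finset Literature.Analysis.FluidPDE Literature.Analysis.FluidPDE.TaoCascade MirrorPulse RenormFrame QuadPolar
  GappedFrontRobustOn

section EntryPhase

variable {ε ε₀ : ℝ}

/-- **THE ENTRY HOP IN ONE CALL**: `TubeStepClockWith ∧ TubeStepEnvelopeWith ∧ TubeStepLandWith` of the split R54 tube at the choice rule,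
hop `n = N₀` (the `hentry` input of `gapData₂On_of_phases`), from the reference flow of the entry hop and scalar rows: clock and envelope by
`tubeStepClockWith_of_continuity` / `tubeStepEnvelopeWith_of_continuity` (p728691), landing by `tubeStepLandWith_entry_of_continuity`.
[cite: Tao2016AveragedNS, §5, §6.2 Prop. 6.3 (ix), §6.3–6.4 Props. 6.4–6.5 (statement shape); route TaoLadderRungTwoFlat, entry hop (cell LADDER §50, §52)] -/
theorem entryHop_of_continuity (P : TubeSchedule) {δs : ℕ → ℝ} {θ' : ℝ} {Wb : ℕ → ℝ} {σ : ℝ} {i₀ : Fin 2}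
    {X₀ : Fin 2 → ℝ} {w : ℤ → ℝ} {r θ₀ c₀ t₀ : ℝ} {ζ : ℕ → Fin 2 → ℤ → ℝ} {ustar : Fin 2 → ℤ → ℝ}
    {good : ℕ → (Fin 2 → ℤ → ℝ → ℝ) → ℝ → Prop} {Z FZ : Fin 2 → ℤ → ℝ → ℝ}
    (hε : 0 ≤ ε) (hε₀ : 0 < ε₀) (hc₀ : 0 < c₀)
    (hζ0 : ζ 0 = datumState i₀ X₀) (hη0 : 0 ≤ P.η 0) (hηN : 0 ≤ P.η P.N₀) (hk₁ : 1 ≤ P.k₁) (hr0 : 0 ≤ r)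
    (hw1 : ∀ k, 1 ≤ w k) (hwc : ∀ k : ℤ, 0 ≤ k → clockW ε₀ k ≤ w k) (hAstar : 0 < P.Astar) (hg : 1 ≤ P.g) (hb : 1 ≤ P.b)
    (hθV : 0 ≤ P.θV) (hθ₀ : 0 ≤ θ₀) (hθ₀1 : θ₀ ≤ 1) (hAFL : 0 < 1 - θ₀ * ε₀) (hσ : 0 ≤ σ) (hσA : 1 + σ ≤ P.Astar)
    (hγ : 0 ≤ P.γ (P.N₀ + 1)) (hδ : 0 ≤ P.δ (P.N₀ + 1)) (hδs : 0 ≤ δs (P.N₀ + 1)) (hv : 0 ≤ P.v (P.N₀ + 1))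
    (hWb : 0 ≤ Wb (P.N₀ + 1))
    -- the reference flow of the entry hop
    (hZ : PseudoFlowOnShift shiftSetFlat c₀ ε₀ (mirrorTable ε ε) 0 0 (ζ P.N₀) (fun i k => (1 / 2) * ζ P.N₀ i k ^ 2)
      (fun _ _ => 0) Z FZ)
    {MZ B D : ℝ} (hMZ : 0 ≤ MZ) (hZb : ∀ i k, ∀ t ∈ Icc 0 c₀, max 1 (clockW ε₀ k) * |Z i k t| ≤ MZ)
    (hζA : AheadClause P w r (ζ P.N₀))
    (hB : 5 / 4 * r + clockW ε₀ P.k₁ * P.η P.N₀ ≤ B)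
    (hD : B * Real.exp (2 * tableAbsSum shiftSetFlat (renormTable ε₀ (mirrorTable ε ε)) * (MZ + 1)
      * (1 + ε₀) ^ ((5 : ℝ) / 2) * c₀) ≤ D)
    (hDhalf : D ≤ 1 / 2)
    -- good section times
    {tlo : ℝ} (htlo : 0 < tlo)
    (hex : ∀ z S₀ τ S F, HopPremiseWith P (splitBcl P (behindR54 P θ' Wb) δs i₀ ustar) shiftSetFlat ε₀ i₀ (mirrorTable ε ε) X₀ w
      r c₀ ζ ustar P.N₀ z S₀ τ S F → ∃ t, good P.N₀ S t)
    (hwin : ∀ z S₀ τ S F, HopPremiseWith P (splitBcl P (behindR54 P θ' Wb) δs i₀ ustar) shiftSetFlat ε₀ i₀ (mirrorTable ε ε) X₀ w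
      r c₀ ζ ustar P.N₀ z S₀ τ S F → ∀ t, good P.N₀ S t → tlo ≤ t ∧ t ≤ c₀)
    -- rows along the reference (clock / landing / envelope); t-independent rows; budgets
    {δ₁ Mω δ₂ δ₃' ρN Mu : ℝ} {env₀ : ℤ → ℝ}
    (hrefK : ∀ t ∈ Icc tlo c₀, (1 + σ) * (1 + ε₀) ^ (-θ₀) + D ≤ |Z i₀ 1 t|)
    (hrefC : ∀ t ∈ Icc tlo c₀, P.Astar * (1 - P.γ (P.N₀ + 1)) * (1 + ε₀) ^ (-θ₀) + D ≤ |Z i₀ 1 t|)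
    (hrefW : ∀ t ∈ Icc tlo c₀, ∀ (i : Fin 2) (k : ℤ), -(P.K : ℤ) ≤ k → k < (P.k₁ : ℤ) →
      MirrorPulse.geomGauge P.g P.b i k * |Z i (1 + k) t - |Z i₀ 1 t| / P.Astar * ustar i k| ≤ δ₁)
    (hMω : ∀ (i : Fin 2) (k : ℤ), -(P.K : ℤ) ≤ k → k < (P.k₁ : ℤ) → MirrorPulse.geomGauge P.g P.b i k * |ustar i k| ≤ Mω)
    (hdom : ∀ (i : Fin 2) (k : ℤ), (P.k₁ : ℤ) ≤ k →
      MirrorPulse.geomGauge P.g P.b i k * (max ((1 + ε₀) ^ (-θ₀)) ((MZ + D) / P.Astar) * r) ≤ 8 * δ₂ * w k)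
    (hutail : ∀ (i : Fin 2) (k : ℤ), (P.k₁ : ℤ) ≤ k → MirrorPulse.geomGauge P.g P.b i k * |ustar i k| ≤ δ₃')
    (hrefN : ∀ t ∈ Icc tlo c₀, ∀ (i : Fin 2) (k : ℤ), -(P.D : ℤ) ≤ k → k ≤ -(P.K : ℤ) - 1 →
      |Z i (1 + k) t - |Z i₀ 1 t| / P.Astar * ustar i k| ≤ ρN)
    (hMu : ∀ (i : Fin 2) (k : ℤ), -(P.D : ℤ) ≤ k → k ≤ -(P.K : ℤ) - 1 → |ustar i k| ≤ Mu)
    (hrefB : ∀ t ∈ Icc tlo c₀, ∀ L : ℕ,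
      R54.behindEnergy P.K L θ' (fun i k => |Z i (1 + k) t| + D) ≤ ((1 + ε₀) ^ (-θ₀)) ^ 2 * Wb (P.N₀ + 1))
    (hbudC : max (P.g ^ P.k₁ * D + δ₁ + D / P.Astar * Mω) (δ₂ + (MZ + D) / P.Astar * δ₃')
      ≤ (1 + ε₀) ^ (-θ₀) * P.δ (P.N₀ + 1))
    (hbudS : max (P.g ^ P.k₁ * D + δ₁ + D / P.Astar * Mω) (δ₂ + (MZ + D) / P.Astar * δ₃')
      ≤ (1 + ε₀) ^ (-θ₀) * δs (P.N₀ + 1))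
    (hbudN : ((Finset.Icc (-(P.D : ℤ)) (-(P.K : ℤ) - 1)).card : ℝ) * (D + ρN + D / P.Astar * Mu) ^ 2
      ≤ ((1 + ε₀) ^ (-θ₀)) ^ 2 * P.v (P.N₀ + 1))
    -- AHEAD / ENVELOPE: window rows, hull and envelope rows read off the reference (+ D); cut schedule
    {kH : ℤ} {Vtop : ℝ} {G Ω : ℤ → ℝ} (hk₁H : (P.k₁ : ℤ) ≤ kH + 2) (hVtop : 0 ≤ Vtop) (hG0 : ∀ j, kH < j → 0 ≤ G j)
    (hrefE : ∀ s ∈ Icc 0 c₀, ∀ (i : Fin 2) (k : ℤ), k ≤ kH + 1 → (1 / 2) * (|Z i k s| + D) ^ 2 ≤ env₀ k)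
    (hrefA : ∀ t ∈ Icc tlo c₀, ∀ (i : Fin 2) (k : ℤ), (P.k₁ : ℤ) ≤ k → k ≤ kH →
      8 * (w k * (|Z i (1 + k) t| + D)) ≤ r * (1 - θ₀ * ε₀))
    (hrefV : ∀ t ∈ Icc 0 c₀, |Z 1 (kH + 1) t| + D ≤ Vtop)
    (hΩ : ∀ j, kH < j → ∀ N : Finset ℤ, (∀ m ∈ N, j < m) → ∑ m ∈ N, (w m)⁻¹ ^ 2 ≤ Ω j)
    (hGΩ : ∀ j, kH < j → 2 * (9 / 8 * r) ^ 2 * Ω j ≤ G j ^ 2)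
    (hclose0 : 4 / 3 * c₀ * clock ε₀ (kH + 1) * Vtop * (Vtop + 2 * ε * G (kH + 1)) < G (kH + 1))
    (hcloseG : ∀ j, kH + 1 ≤ j →
      4 / 3 * c₀ * clock ε₀ (j + 1) * (2 * G j) * (2 * G j + 2 * ε * G (j + 1)) < G (j + 1))
    (hGr : ∀ k, kH < k → 8 * (w k * (2 * G k)) ≤ r * (1 - θ₀ * ε₀))
    (henvA : ∀ m : ℤ, kH + 1 < m → 2 * G (m - 1) ^ 2 ≤ env₀ m) :
    TubeStepClockWith P (splitBcl P (behindR54 P θ' Wb) δs i₀ ustar) (choiceRule P i₀ ε₀ θ₀ t₀ good) shiftSetFlat σ ε₀ i₀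
        (mirrorTable ε ε) X₀ w r θ₀ c₀ ζ ustar P.N₀ ∧
      TubeStepEnvelopeWith P (splitBcl P (behindR54 P θ' Wb) δs i₀ ustar) (choiceRule P i₀ ε₀ θ₀ t₀ good) shiftSetFlat ε₀ i₀
        (mirrorTable ε ε) X₀ w r c₀ env₀ ζ ustar P.N₀ ∧
      TubeStepLandWith P (splitBcl P (behindR54 P θ' Wb) δs i₀ ustar) (choiceRule P i₀ ε₀ θ₀ t₀ good) shiftSetFlat ε₀ i₀
        (mirrorTable ε ε) X₀ w r c₀ ζ ustar P.N₀ := by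
  have hdev := dev_of_capturePremise (Bcl := splitBcl P (behindR54 P θ' Wb) δs i₀ ustar) (ustar := ustar) P hε₀ le_rfl hc₀
    hζ0 hη0 hηN hk₁ hr0 hw1 hwc hZ hMZ hZb hζA hB hD hDhalf
  exact ⟨tubeStepClockWith_of_continuity P hε₀ hσ hσA hdev htlo hex hwin hrefK,
    tubeStepEnvelopeWith_of_continuity P hε hε₀ le_rfl hc₀ hζ0 hη0 hk₁ hr0 hw1 hdev hex hwin hk₁H hVtop hG0 hrefE hrefV hΩ
      hGΩ hclose0 hcloseG henvA,
    tubeStepLandWith_entry_of_continuity P hε hε₀ hc₀ hζ0 hη0 hηN hk₁ hr0 hw1 hwc hAstar hg hb hθV hθ₀ hθ₀1 hAFL hγ hδ hδs hv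
      hWb hZ hMZ hZb hζA hB hD hDhalf htlo hex hwin hrefC hrefW hMω hdom hutail hrefN hMu hrefB hbudC hbudS hbudN hk₁H hVtop
      hG0 hrefA hrefV hΩ hGΩ hclose0 hcloseG hGr⟩

end EntryPhase

end Summit.NavierStokesRegularity.NavierStokesRegularity.Theorems.HopTube

end
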